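import Summits.ValiantsHypothesis.ValiantsHypothesis.Theses.LacunarySymmetroid
import Summits.ValiantsHypothesis.ValiantsHypothesis.Theorems.MatrixDescartes.Negative.MatrixDescartesSymmetryFree

/-!
# `MatrixDescartes`, line `Lift` — the hard stub C⁺ (`OneIndefiniteDescartes`) is implied by the crux

Line `Lift` (`Cruxes/MatrixDescartes/Lines/Lift.lean`) proves `OneIndefiniteDescartes → MatrixDescartes`
(the PSD lift; all delegated stubs landed).  This file proves the CONVERSE
`MatrixDescartes → OneIndefiniteDescartes` (`oneIndefiniteDescartes_of_matrixDescartes`), so the line's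
one open stub is EXACTLY crux-hard — no stronger, no weaker: the line is an honest normal form with zero
slack, and a disprover gains nothing by attacking C⁺ instead of the crux (nor loses anything).

Route: `MatrixDescartes ⇒ MatrixDescartesGeneral` (symmetry-free form, landed
`…Negative.MatrixDescartesSymmetryFree`) ⇒ transport the C⁺ instance (arbitrary `Fintype` index types
`ι`, `κ`; the extra term `X^e • J`) along `Fintype.equivFin` to a general pencil with `card κ + 1` terms
on `Fin (card ι)`, with `(c, q) ↦ (c, 2q)` and `K₀ ↦ max K₀ 4`; positivity and symmetry of the
coefficients are simply forgotten.

`OneIndefiniteDescartes` is restated VERBATIM from the line file (which carries the lead's `sorry` and is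
therefore not imported); the two `def`s agree by `Iff.rfl`. [folklore]
-/

-- `Summit.ValiantsHypothesis.ValiantsHypothesis.…` repeats a component by the D-0017 layout
-- (single-conjunct summit), which the `dupNamespace` linter flags; the name is mandated.
set_option linter.dupNamespace false

namespace Summit.ValiantsHypothesis.ValiantsHypothesis.Theorems.MatrixDescartes.Negative

open Summit.ValiantsHypothesis.ValiantsHypothesis.Theses.LacunarySymmetroid
open scoped BigOperators Matrix
open Polynomial

/-- **C⁺ of line `Lift`** (verbatim copy of `Cruxes/MatrixDescartes/Lines/Lift.lean:
OneIndefiniteDescartes`): MDR restricted to pencils `X^e • J + ∑ₖ X^{d k} • P k` with one constant real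
symmetric `J` and positive semidefinite `P k`, over arbitrary finite index types. -/
def OneIndefiniteDescartes : Prop :=
  ∀ c q : ℕ, 0 < q → ∃ K₀ : ℕ, ∀ (ι κ : Type) [Fintype ι] [DecidableEq ι] [Fintype κ],
    K₀ ≤ Fintype.card κ → Fintype.card ι ≤ 2 ^ ((Nat.log 2 (Fintype.card κ) + c) ^ c) →
    ∀ (e : ℕ) (d : κ → ℕ) (J : Matrix ι ι ℝ) (P : κ → Matrix ι ι ℝ),
      J.IsSymm → (∀ k, (P k).PosSemidef) →
      (Matrix.det (((Polynomial.X : Polynomial ℝ) ^ e) • J.map Polynomial.C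
          + ∑ k, ((Polynomial.X : Polynomial ℝ) ^ d k) • (P k).map Polynomial.C)).roots.toFinset.card ^ q
        ≤ 2 ^ (Fintype.card κ * Nat.log 2 (Fintype.card κ))

section Transport

variable {ι κ : Type} [Fintype ι] [DecidableEq ι] [Fintype κ]

/-- exponents of the transported pencil: `e` first, then `d` along `Fintype.equivFin κ` -/
noncomputable def dT (e : ℕ) (d : κ → ℕ) : Fin (Fintype.card κ + 1) → ℕ :=
  Fin.cons e fun l => d ((Fintype.equivFin κ).symm l)

/-- coefficients of the transported pencil: `J` first, then the `P k`, reindexed to `Fin (card ι)` -/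
noncomputable def TT (J : Matrix ι ι ℝ) (P : κ → Matrix ι ι ℝ) :
    Fin (Fintype.card κ + 1) → Matrix (Fin (Fintype.card ι)) (Fin (Fintype.card ι)) ℝ :=
  Fin.cons (Matrix.reindex (Fintype.equivFin ι) (Fintype.equivFin ι) J)
    fun l => Matrix.reindex (Fintype.equivFin ι) (Fintype.equivFin ι) (P ((Fintype.equivFin κ).symm l))

omit [DecidableEq ι] in
/-- the transported pencil is the reindexing of the C⁺ pencil -/
theorem pencil_TT (e : ℕ) (d : κ → ℕ) (J : Matrix ι ι ℝ) (P : κ → Matrix ι ι ℝ) :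
    (∑ l, (X : ℝ[X]) ^ dT e d l • (TT J P l).map Polynomial.C) =
      Matrix.reindex (Fintype.equivFin ι) (Fintype.equivFin ι)
        (((Polynomial.X : Polynomial ℝ) ^ e) • J.map Polynomial.C
          + ∑ k, ((Polynomial.X : Polynomial ℝ) ^ d k) • (P k).map Polynomial.C) := by
  rw [Fin.sum_univ_succ]
  have hsum : (∑ l : Fin (Fintype.card κ),
      (X : ℝ[X]) ^ dT e d l.succ • (TT J P l.succ).map Polynomial.C)
      = ∑ k, (X : ℝ[X]) ^ d k •
          (Matrix.reindex (Fintype.equivFin ι) (Fintype.equivFin ι) (P k)).map Polynomial.C := by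
    simp only [dT, TT, Fin.cons_succ]
    exact Equiv.sum_comp (Fintype.equivFin κ).symm
      (fun k => (X : ℝ[X]) ^ d k •
        (Matrix.reindex (Fintype.equivFin ι) (Fintype.equivFin ι) (P k)).map Polynomial.C)
  rw [hsum]
  ext i j
  simp [dT, TT, Matrix.sum_apply]

/-- hence the same determinant and the same distinct real zeros -/
theorem card_roots_TT (e : ℕ) (d : κ → ℕ) (J : Matrix ι ι ℝ) (P : κ → Matrix ι ι ℝ) :
    (∑ l, (X : ℝ[X]) ^ dT e d l • (TT J P l).map Polynomial.C).det.roots.toFinset.card =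
      (Matrix.det (((Polynomial.X : Polynomial ℝ) ^ e) • J.map Polynomial.C
          + ∑ k, ((Polynomial.X : Polynomial ℝ) ^ d k) • (P k).map Polynomial.C)).roots.toFinset.card := by
  rw [pencil_TT, Matrix.det_reindex_self]

end Transport

/-- **C⁺ is not stronger than the crux**: `MatrixDescartes → OneIndefiniteDescartes`
(with `(c, q) ↦ (c, 2q)`, `K₀ ↦ max K₀ 4`; PSD-ness and symmetry are forgotten). Together with the
line's `MatrixDescartes_of_oneIndefinite` this makes C⁺ ≅ crux. [folklore] -/
theorem oneIndefiniteDescartes_of_matrixDescartes (h : MatrixDescartes) : OneIndefiniteDescartes := by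
  have hG := matrixDescartesGeneral_of_matrixDescartes h
  intro c q hq
  obtain ⟨K₀, hK⟩ := hG c (2 * q) (by omega)
  refine ⟨max K₀ 4, ?_⟩
  intro ι κ _ _ _ hK₀ hι e d J P _ _
  have hK4 : 4 ≤ Fintype.card κ := le_of_max_le_right hK₀
  have hK₀' : K₀ ≤ Fintype.card κ + 1 := by
    have := le_of_max_le_left hK₀
    omega
  have hL2 : 2 ≤ Nat.log 2 (Fintype.card κ) :=
    calc 2 = Nat.log 2 4 := by decide
      _ ≤ Nat.log 2 (Fintype.card κ) := Nat.log_mono_right hK4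
  have hL' : Nat.log 2 (Fintype.card κ + 1) ≤ Nat.log 2 (Fintype.card κ) + 1 :=
    calc Nat.log 2 (Fintype.card κ + 1) ≤ Nat.log 2 (Fintype.card κ * 2) :=
          Nat.log_mono_right (by omega)
      _ = Nat.log 2 (Fintype.card κ) + 1 := Nat.log_mul_base (by norm_num) (by omega)
  have hsize : Fintype.card ι ≤ 2 ^ ((Nat.log 2 (Fintype.card κ + 1) + c) ^ c) :=
    hι.trans (Nat.pow_le_pow_right (by norm_num)
      (Nat.pow_le_pow_left (Nat.add_le_add_right (Nat.log_mono_right (Nat.le_succ _)) c) c))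
  have h1 := hK (Fintype.card κ + 1) (Fintype.card ι) hK₀' hsize (dT e d) (TT J P)
  rw [card_roots_TT] at h1
  have h2 : (Fintype.card κ + 1) * Nat.log 2 (Fintype.card κ + 1)
      ≤ 2 * (Fintype.card κ * Nat.log 2 (Fintype.card κ)) :=
    calc (Fintype.card κ + 1) * Nat.log 2 (Fintype.card κ + 1)
          ≤ (Fintype.card κ + 1) * (Nat.log 2 (Fintype.card κ) + 1) := Nat.mul_le_mul_left _ hL'
      _ ≤ 2 * (Fintype.card κ * Nat.log 2 (Fintype.card κ)) := by nlinarith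
  have h3 : ((Matrix.det (((Polynomial.X : Polynomial ℝ) ^ e) • J.map Polynomial.C
          + ∑ k, ((Polynomial.X : Polynomial ℝ) ^ d k) • (P k).map Polynomial.C)
            ).roots.toFinset.card ^ q) ^ 2
      ≤ (2 ^ (Fintype.card κ * Nat.log 2 (Fintype.card κ))) ^ 2 :=
    calc ((Matrix.det (((Polynomial.X : Polynomial ℝ) ^ e) • J.map Polynomial.C
          + ∑ k, ((Polynomial.X : Polynomial ℝ) ^ d k) • (P k).map Polynomial.C)
            ).roots.toFinset.card ^ q) ^ 2
          = (Matrix.det (((Polynomial.X : Polynomial ℝ) ^ e) • J.map Polynomial.C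
              + ∑ k, ((Polynomial.X : Polynomial ℝ) ^ d k) • (P k).map Polynomial.C)
                ).roots.toFinset.card ^ (2 * q) := by rw [← pow_mul, mul_comm]
      _ ≤ 2 ^ ((Fintype.card κ + 1) * Nat.log 2 (Fintype.card κ + 1)) := h1
      _ ≤ 2 ^ (2 * (Fintype.card κ * Nat.log 2 (Fintype.card κ))) :=
          Nat.pow_le_pow_right (by norm_num) h2
      _ = (2 ^ (Fintype.card κ * Nat.log 2 (Fintype.card κ))) ^ 2 := by rw [← pow_mul, mul_comm]
  exact (Nat.pow_le_pow_iff_left two_ne_zero).1 h3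

end Summit.ValiantsHypothesis.ValiantsHypothesis.Theorems.MatrixDescartes.Negative
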